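import Literature.NumberTheory.DiophantineGeometry.AbelianVarietyOrdinaryReductionFiltrationProofs
import Literature.NumberTheory.DiophantineGeometry.AbelianSchemeModelSpecialFibre
import Literature.NumberTheory.DiophantineGeometry.WeilPairingRationalTateModule
import HarnessLib

/-!
# The ordinary filtration of `V_p B`: what remains after the Weil pairing and the special fibre

`Proofs` file (theorems only), sibling of `AbelianVarietyOrdinaryReductionFiltrationProofs` and
`AbelianSchemeModelSpecialFibre`, supporting the named fact
`Literature.NumberTheory.DiophantineGeometry.ordinaryReduction_tateModule_filtration`
(Greenberg 1991, §2; Serre–Tate 1968, §1; Shatz 1986, §6–§7).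

`ordinaryReduction_tateModule_filtration_of_reductionData` (the assembly) reduces the fact to a
reduction datum, a Weil pairing and an isotropy statement.  Two of its inputs are meanwhile in the
tree: the torsion count of the special fibre (`exists_specialFibre_natCard_geomTorsion_pow`: for
good ordinary reduction at `v ∣ p` the special fibre abelian variety `𝒜_v` of a model has
`#𝒜_v[pⁿ](κ̄(v)) = p^{(dim B) n}`) and the Weil pairing as the NAMED FACT
`weilPairing_rationalTateModule` (Milne 1986, §16; unproved in the tree, consumed here as an
explicit hypothesis, D-0014).  This file records the sharper reduction

* `ordinaryReduction_tateModule_filtration_of_reductionMap` — **the fact follows from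
  `weilPairing_rationalTateModule` and, for every abelian-scheme model `𝒜` of `B` at `v ∣ p` with
  ordinary special fibre, a REDUCTION MAP `red : B(K̄) → 𝒜_v(κ̄(v))` onto the geometric points of
  the special fibre abelian variety (`IsAbelianSchemeModel.specialFibre`) which is a homomorphism,
  `Γ_{K_v}`-equivariant for some action of `Γ_{K_v}` on `𝒜_v(κ̄(v))` under which inertia acts
  trivially, maps `B[pⁿ]` onto `𝒜_v[pⁿ]`, and whose `V_p`-kernel is isotropic for every
  `Γ_K`-equivariant-up-to-`χ_p` bilinear form on `V_p B`** (Serre–Tate 1968, §1: the reduction map;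
  isotropy: such forms are homomorphisms `𝒢 → 𝒢^D` of the `p`-divisible group `𝒢 = 𝒜[p^∞]` by
  Tate's theorem (Tate 1967, Thm. 4; Shatz 1986, §6 "Theorem (Tate)" and Cor. 1), which map the
  connected part `𝒢⁰` into `(𝒢^D)⁰ = (𝒢^{ét})^D` in the ordinary case, so `V_p(𝒢⁰) = ker V_p(red)`
  pairs trivially with itself).

So the remaining content of the fact is exactly: the reduction map of an abelian-scheme model with
these properties, and the Weil pairing.  (To supply instead ONE polarisation pairing together with
the isotropy of the kernel of reduction for it, use `ordinaryReduction_tateModule_filtration_of_reductionData`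
directly.)

## References

* [Greenberg1991] R. Greenberg, *Iwasawa theory for motives*, LMS LNS 153 (1991), §2, p. 214.
* [SerreTate1968GoodReduction] J.-P. Serre, J. Tate, Ann. of Math. 88 (1968), §1.
* [Shatz1986GroupSchemes] S. S. Shatz, in *Arithmetic Geometry* (1986), §6–§7.
* [Milne1986AbelianVarieties] J. S. Milne, *Abelian Varieties*, §16 (the Weil pairing).
-/

noncomputable section

open scoped AddSubgroup TensorProduct NumberField
open Field IsDedekindDomain IsDedekindDomain.HeightOneSpectrum CategoryTheory
open Literature.NumberTheory.GaloisRepresentations Literature.NumberTheory.EllipticCurves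
open Literature.AlgebraicGeometry.Motives (AbelianVariety SchemeOver)

namespace Literature.NumberTheory.DiophantineGeometry

/-- **`ordinaryReduction_tateModule_filtration` from the Weil pairing and reduction maps.**  Assume
the named fact `weilPairing_rationalTateModule` (Milne 1986, §16) and that every abelian-scheme
model `𝒜` at `v ∣ p` of an abelian variety `B` over a number field, with ordinary special fibre,
carries a reduction map `red : B(K̄) → 𝒜_v(κ̄(v))` — an additive homomorphism to the geometric
points of the special fibre abelian variety, equivariant along `res : Γ_{K_v} → Γ_K` for some
action of `Γ_{K_v}` on `𝒜_v(κ̄(v))` with inertia acting trivially, mapping `B[pⁿ]` onto `𝒜_v[pⁿ]`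
for all `n` (Serre–Tate 1968, §1) — whose kernel on `V_p B` is isotropic for every bilinear form
`e` on `V_p B` with `e(gx, gy) = χ_p(g) e(x, y)` (by Tate's theorem such `e` are homomorphisms
`𝒜[p^∞] → 𝒜[p^∞]^D`, under which the connected part is self-orthogonal in the ordinary case:
Shatz 1986, §6).  Then the fact holds: the torsion
count `#𝒜_v[pⁿ](κ̄(v)) = p^{(dim B) n}` is `IsAbelianSchemeModel.natCard_geomTorsion_specialFibre_pow`
and the rest is the assembly `exists_ordinaryFiltration_of_reduction`.
[cite: Greenberg1991, §2 (p. 214)] -/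
theorem ordinaryReduction_tateModule_filtration_of_reductionMap
    (hW : weilPairing_rationalTateModule)
    (hred : ∀ {K : Type} [Field K] [NumberField K] (B : AbelianVariety K)
      (v : HeightOneSpectrum (𝓞 K)) (p : ℕ) [Fact p.Prime]
      (𝒜 : SchemeOver (valuationSubringAtPrime K v)) (_ : GrpObj 𝒜)
      (h : IsAbelianSchemeModel B v 𝒜),
      ((p : ℕ) : 𝓞 K) ∈ v.asIdeal →
      specialFibrePTorsionCard v 𝒜 = residueChar v ^ B.dim →
      ∃ (_ : DistribMulAction (absoluteGaloisGroup (v.adicCompletion K))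
          h.specialFibre.geomPoints)
        (red : B.geomPoints →+ h.specialFibre.geomPoints),
        (∀ (τ : absoluteGaloisGroup (v.adicCompletion K)) (P : B.geomPoints),
            red (absGaloisRestrict K (v.adicCompletion K) τ • P) = τ • red P) ∧
        (∀ τ ∈ absInertia (v.adicCompletion K), ∀ y : h.specialFibre.geomPoints, τ • y = y) ∧
        (∀ n, ∀ y ∈ (h.specialFibre.geomPoints)[(p ^ n : ℕ)],
            ∃ x ∈ (B.geomPoints)[(p ^ n : ℕ)], red x = y) ∧
        (∀ e : LinearMap.BilinForm ℚ_[p] (B.rationalTateModule p),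
          (∀ (g : absoluteGaloisGroup K) (x y : B.rationalTateModule p),
              e (B.rationalTateRep p g x) (B.rationalTateRep p g y) =
                (((GaloisRep.cyclotomicCharacter K p g : ℤ_[p]ˣ) : ℤ_[p]) : ℚ_[p]) * e x y) →
          ∀ x y : B.rationalTateModule p,
            (TateModule.map p red).baseChange ℚ_[p] x = 0 →
              (TateModule.map p red).baseChange ℚ_[p] y = 0 → e x y = 0)) :
    ordinaryReduction_tateModule_filtration := by
  refine ordinaryReduction_tateModule_filtration_of_reductionData @fun K _ _ B v p _ hpv hord ↦ ?_
  obtain ⟨𝒜, inst, h, hcard⟩ := hord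
  obtain ⟨act, red, hequiv, hI, hsurj, hiso⟩ := hred B v p 𝒜 inst h hpv hcard
  haveI : NeZero (p : K) := ⟨Nat.cast_ne_zero.mpr (Fact.out : p.Prime).ne_zero⟩
  obtain ⟨e, -, he, heq⟩ := hW B p (NeZero.ne _)
  exact ⟨h.specialFibre.geomPoints, inferInstance, act, red, e, hequiv, hI,
    fun n ↦ h.natCard_geomTorsion_specialFibre_pow hpv hcard n, hsurj, he, heq, hiso e heq⟩

end Literature.NumberTheory.DiophantineGeometry
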